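import Summits.Parity.BatemanHorn.Theorems.AlmostPrimeZerosSystemLSDRealSegmentReductionCore
import HarnessLib

/-!
# Route `AlmostPrimeZeros`, crux `SystemLSDRealSegment` (stmt-Parity-11292), line
# `beta-thinned-root-kernel`: the TRUNCATED thinned-divisor expansion (`truncStat_expansion`)

The line's exact expansion `y^{s_f(n)} = Σ_{d ∈ tuples f n} ∏ᵢ h_y(dᵢ)` (`pow_stat_eq_sum_tuples`, file
`…ReductionCore.lean`) truncated at a smoothness height `S`: counting on the left only the primes `p < S`,
`s_{f,S}(n) = Σᵢ Σ_{p < S} min(v_p(fᵢ(n)), 2)`, one gets on the right exactly the divisor tuples whose product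
`∏ dᵢ` is `S`-smooth (`Nat.smoothNumbers S`):

  `y^{s_{f,S}(n)} = Σ_{d ∈ tuples f n, ∏ dᵢ S-smooth} ∏ᵢ h_y(dᵢ)`.

Proof.  One variable first (`pow_truncCapped_eq_sum_divisors`, `pow_truncCapped_eq_sum_divSet`): as arithmetic
functions, `(𝟙_{S-smooth} · h_y) * ζ = y^{s_S}`, both sides multiplicative (a product of coprime numbers is
`S`-smooth iff both factors are), and on prime powers `p^i`: for `p < S` every `p^j` is `S`-smooth and
`Σ_{j ≤ i} thinCoeff y j = y^{min(i,2)}` (`sum_thinCoeff_range'`); for `p ≥ S` only `j = 0` survives and the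
exponent is `0`.  Then the tuple version exactly as `pow_stat_eq_sum_tuples` (`Finset.prod_pow_eq_pow_sum`,
`Finset.prod_univ_sum`), identifying the tuples with `S`-smooth product with the product set of the
coordinatewise `S`-smooth divisors (`prod_mem_smoothNumbers_iff`: a finite product is `S`-smooth iff every
factor is).  Pure finite multiplicative combinatorics over Mathlib and the line's vocabulary file
`…/Theorems/AlmostPrimeZerosDefs.lean`.

References: G. Tenenbaum, *Introduction to analytic and probabilistic number theory* (2015), III.5 (smooth
numbers, truncated multiplicative functions); the line card
`Cruxes/SystemLSDRealSegment/Lines/beta-thinned-root-kernel.md`.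
-/

open Filter Finset Polynomial
open scoped BigOperators Topology

namespace Summit.Parity.BatemanHorn.Cruxes.SystemLSDRealSegment.BetaThinnedRootKernel

open Literature.NumberTheory.Sieve

noncomputable section

/-! ### Smooth-number bookkeeping -/

/-- `0` is never `S`-smooth. [folklore] -/
theorem zero_not_mem_smoothNumbers' (S : ℕ) : (0 : ℕ) ∉ Nat.smoothNumbers S :=
  fun h => Nat.ne_zero_of_mem_smoothNumbers h rfl

/-- For a prime `p < S`, every power `p^j` is `S`-smooth. [folklore] -/
theorem prime_pow_mem_smoothNumbers_of_lt {S p : ℕ} (hp : p.Prime) (hpS : p < S) (j : ℕ) :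
    p ^ j ∈ Nat.smoothNumbers S :=
  Nat.mem_smoothNumbers'.2 fun q hq hqd =>
    lt_of_eq_of_lt (a := q) ((Nat.prime_dvd_prime_iff_eq hq hp).1 (hq.dvd_of_dvd_pow hqd)) hpS

/-- For a prime `p ≥ S`, no positive power `p^(j+1)` is `S`-smooth. [folklore] -/
theorem prime_pow_succ_not_mem_smoothNumbers_of_le {S p : ℕ} (hp : p.Prime) (hpS : S ≤ p) (j : ℕ) :
    p ^ (j + 1) ∉ Nat.smoothNumbers S :=
  fun h => absurd (Nat.mem_smoothNumbers'.1 h p hp (dvd_pow_self p (Nat.succ_ne_zero j))) (not_lt.2 hpS)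

/-- A finite product of natural numbers is `S`-smooth iff every factor is. [folklore] -/
theorem prod_mem_smoothNumbers_iff {ι : Type*} (s : Finset ι) (d : ι → ℕ) (S : ℕ) :
    (∏ i ∈ s, d i) ∈ Nat.smoothNumbers S ↔ ∀ i ∈ s, d i ∈ Nat.smoothNumbers S := by
  constructor
  · intro h i hi
    exact Nat.mem_smoothNumbers_of_dvd h (Finset.dvd_prod_of_mem d hi)
  · intro h
    rw [Nat.mem_smoothNumbers']
    intro p hp hpd
    obtain ⟨i, hi, hpi⟩ := hp.prime.exists_mem_finset_dvd hpd
    exact Nat.mem_smoothNumbers'.1 (h i hi) p hp hpi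

/-- The tuples of a product set whose product is `S`-smooth form the product set of the coordinatewise
`S`-smooth members. [folklore] -/
theorem piFinset_filter_prod_mem_smoothNumbers {k : ℕ} (t : Fin k → Finset ℕ) (S : ℕ) :
    (Fintype.piFinset t).filter (fun d => (∏ i, d i) ∈ Nat.smoothNumbers S) =
      Fintype.piFinset fun i => (t i).filter (· ∈ Nat.smoothNumbers S) := by
  ext d
  simp only [Finset.mem_filter, Fintype.mem_piFinset, prod_mem_smoothNumbers_iff, Finset.mem_univ,
    true_implies, forall_and]

/-! ### The truncated capped statistic `s_S(m) = Σ_{p < S} min(v_p(m), 2)` -/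

/-- `s_S(p^j) = min(j,2)` if `p < S`, else `0`. [folklore] -/
theorem truncCapped_prime_pow (S : ℕ) {p : ℕ} (hp : p.Prime) (j : ℕ) :
    ((p ^ j).factorization.sum fun q v => if q < S then min v 2 else 0) =
      if p < S then min j 2 else 0 := by
  rw [hp.factorization_pow, Finsupp.sum_single_index (by simp)]

/-- `s_S` is additive on coprime arguments. [folklore] -/
theorem truncCapped_mul (S : ℕ) {m n : ℕ} (hm : m ≠ 0) (hn : n ≠ 0) (h : m.Coprime n) :
    ((m * n).factorization.sum fun q v => if q < S then min v 2 else 0) =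
      (m.factorization.sum fun q v => if q < S then min v 2 else 0) +
        (n.factorization.sum fun q v => if q < S then min v 2 else 0) := by
  rw [Nat.factorization_mul hm hn, Finsupp.sum_add_index_of_disjoint]
  simpa only [Nat.support_factorization] using h.disjoint_primeFactors

/-! ### The truncated expansion in one variable -/

section Identity

variable {R : Type*} [CommRing R]

/-- **THE TRUNCATED EXPANSION** `y^{s_S(m)} = Σ_{d ∣ m, d S-smooth} h_y(d)` for `m ≥ 1` (as arithmetic functions,
`(𝟙_{S-smooth} h_y) * ζ = y^{s_S}`, both sides multiplicative, compared on prime powers). [folklore] -/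
theorem pow_truncCapped_eq_sum_divisors (y : R) (S : ℕ) {m : ℕ} (hm : m ≠ 0) :
    y ^ (m.factorization.sum fun q v => if q < S then min v 2 else 0) =
      ∑ d ∈ m.divisors.filter (· ∈ Nat.smoothNumbers S), thinWeight y d := by
  have one_mem : 1 ∈ Nat.smoothNumbers S := ⟨one_ne_zero, fun p hp => by simp at hp⟩
  -- the two arithmetic functions, built inline
  let hA : ArithmeticFunction R :=
    ⟨fun d => if d ∈ Nat.smoothNumbers S then thinWeight y d else 0, if_neg (zero_not_mem_smoothNumbers' S)⟩
  let cA : ArithmeticFunction R :=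
    ⟨fun n => if n = 0 then 0 else y ^ (n.factorization.sum fun q v => if q < S then min v 2 else 0),
      if_pos rfl⟩
  have hA_apply : ∀ d : ℕ, hA d = if d ∈ Nat.smoothNumbers S then thinWeight y d else 0 := fun _ => rfl
  have cA_apply : ∀ {n : ℕ}, n ≠ 0 →
      cA n = y ^ (n.factorization.sum fun q v => if q < S then min v 2 else 0) := fun {n} hn => if_neg hn
  have hA_mult : hA.IsMultiplicative := by
    refine ⟨by rw [hA_apply, if_pos one_mem, thinWeight_one], ?_⟩
    intro a b hab
    rw [hA_apply, hA_apply, hA_apply]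
    by_cases ha : a ∈ Nat.smoothNumbers S
    · by_cases hb : b ∈ Nat.smoothNumbers S
      · rw [if_pos (Nat.mul_mem_smoothNumbers ha hb), if_pos ha, if_pos hb]
        exact thinWeight_mul y ha.1 hb.1 hab
      · rw [if_neg hb, mul_zero, if_neg]
        exact fun h => hb (Nat.mem_smoothNumbers_of_dvd h (dvd_mul_left b a))
    · rw [if_neg ha, zero_mul, if_neg]
      exact fun h => ha (Nat.mem_smoothNumbers_of_dvd h (dvd_mul_right a b))
  have cA_mult : cA.IsMultiplicative := by
    refine ⟨by rw [cA_apply one_ne_zero]; simp, ?_⟩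
    intro a b hab
    rcases eq_or_ne a 0 with rfl | ha
    · simp [cA]
    rcases eq_or_ne b 0 with rfl | hb
    · simp [cA]
    rw [cA_apply (mul_ne_zero ha hb), cA_apply ha, cA_apply hb, truncCapped_mul S ha hb hab, pow_add]
  have key : hA * (ArithmeticFunction.zeta : ArithmeticFunction R) = cA := by
    rw [ArithmeticFunction.IsMultiplicative.eq_iff_eq_on_prime_powers _
      (hA_mult.mul ArithmeticFunction.isMultiplicative_zeta.natCast) _ cA_mult]
    intro p i hp
    rw [ArithmeticFunction.coe_mul_zeta_apply, Nat.sum_divisors_prime_pow hp,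
      cA_apply (pow_ne_zero _ hp.ne_zero), truncCapped_prime_pow S hp]
    by_cases hpS : p < S
    · rw [if_pos hpS, Finset.sum_congr rfl fun j _ => by
        rw [hA_apply, if_pos (prime_pow_mem_smoothNumbers_of_lt hp hpS j), thinWeight_prime_pow y hp]]
      exact sum_thinCoeff_range' y i
    · rw [if_neg hpS, pow_zero, Finset.sum_range_succ', pow_zero, hA_apply 1,
        if_pos one_mem, thinWeight_one,
        Finset.sum_eq_zero fun j _ => by
          rw [hA_apply, if_neg (prime_pow_succ_not_mem_smoothNumbers_of_le hp (not_lt.1 hpS) j)],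
        zero_add]
  have h := congrArg (fun F : ArithmeticFunction R => F m) key
  rw [ArithmeticFunction.coe_mul_zeta_apply, cA_apply hm] at h
  rw [← h, Finset.sum_filter]
  exact Finset.sum_congr rfl fun d _ => hA_apply d

/-- The truncated expansion with the `0 ↦ {1}` convention (`divSet`), for EVERY `m : ℕ`, with the stub's inner sum
verbatim. [folklore] -/
theorem pow_truncCapped_eq_sum_divSet (y : R) (S m : ℕ) :
    y ^ (m.factorization.sum fun q v => if q < S then min v 2 else 0) =
      ∑ d ∈ (divSet m).filter (· ∈ Nat.smoothNumbers S), thinWeight y d := by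
  rcases eq_or_ne m 0 with rfl | hm
  · have one_mem : 1 ∈ Nat.smoothNumbers S := ⟨one_ne_zero, fun p hp => by simp at hp⟩
    have h1 : divSet 0 = {1} := by rw [divSet, max_eq_right (Nat.zero_le 1), Nat.divisors_one]
    rw [h1, Finset.filter_singleton, if_pos one_mem, Finset.sum_singleton, thinWeight_one]
    simp
  · rw [divSet, max_eq_left (Nat.one_le_iff_ne_zero.2 hm)]
    exact pow_truncCapped_eq_sum_divisors y S hm

end Identity

/-! ### The registered stub -/

/-- **truncStat_expansion** (registered stub of the line `beta-thinned-root-kernel`): the system expansion over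
divisor TUPLES truncated at height `S` —
`y^{Σᵢ Σ_{p<S} min(v_p(fᵢ(n)),2)} = Σ_{d ∈ tuples f n, ∏ dᵢ S-smooth} ∏ᵢ h_y(dᵢ)`, for every family `f`, real `y`,
`S` and `n`. [folklore] -/
theorem truncStat_expansion :
    ∀ (k : ℕ) (f : Fin k → ℤ[X]) (y : ℝ) (S n : ℕ),
      y ^ (∑ i, (((f i).eval (n : ℤ)).toNat.factorization.sum fun p v => if p < S then min v 2 else 0)) =
        ∑ d ∈ (tuples f n).filter (fun d => (∏ i, d i) ∈ Nat.smoothNumbers S), ∏ i, thinWeight y (d i) := by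
  intro k f y S n
  rw [← Finset.prod_pow_eq_pow_sum,
    Finset.prod_congr rfl fun i _ => pow_truncCapped_eq_sum_divSet y S ((f i).eval (n : ℤ)).toNat,
    Finset.prod_univ_sum, tuples, piFinset_filter_prod_mem_smoothNumbers]

end

end Summit.Parity.BatemanHorn.Cruxes.SystemLSDRealSegment.BetaThinnedRootKernel
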